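import Mathlib.Analysis.SpecialFunctions.Exponential
import Mathlib.Analysis.SpecialFunctions.Log.Basic
import Mathlib.Algebra.Order.BigOperators.Group.Finset
import HarnessLib

/-!
# Dimock, *Ultraviolet stability for QED in d = 3*, §4.2.1 «fermion integral — large fields region», LEMMA 21 (458)
# «`Z′_{k,Ω}(0)∕Z_f(N,0) ≤ e^{(Mr_K)⁴}Π_{j=0}^{K−1}exp(O(1)|Ω^{(j+1),c}_{j+1}|)`» — the ratio of the free-fermion
# normalization factors WITH and WITHOUT the large-field regions: its printed proof (459)–(466) (the regional∕global
# polymer sums differ only in polymers meeting `Ω^c`, tree decay makes the difference `O(Vol(Ω^c))`) PROVED as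
# finite-sum bookkeeping, and (458) assembled with LEMMA 22's `|det C_K(0)| ≤ e^{(Mr_K)⁴}`

statement-level skeleton of published theorems with citation tags; proofs where landed; nothing here is a claim about the Yang–Mills mass gap

**Citation header (reproduction of PUBLISHED work).** J. Dimock, *Ultraviolet stability for QED in d = 3*, Ann. Henri
Poincaré **23** (2022) 2113–2205 (= arXiv:2009.01156v2) [Dimock2022UVStabilityQED3], §4.2.1 LEMMA 21 (458) p.62 L65–78
with its proof (459)–(466) p.62 L79 – p.63 L51 and LEMMA 22 (467) p.63 L52–55 (in the tree: `QED3FinalCovarianceDeterminant`,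
`lemma22_det_bound`), of the held arXiv text layer `paper:arxiv-2009.01156` (`p.NN Lnn` = PDF page ∕ text-layer line).
Writer seat p11 (literature-prover-lit-balaban-p11-g26-0), YM LIT SWEEP item (c) D8 (row C08; zero weight for the YM-INPRINT
tokens — LEMMA 21 is a factor of LEMMA 19∕20's bound entering (491)).  Mathlib only.

**The printed text (verbatim, text layer).**  p.62 L65–78: *"We also need a bound on `Z′_{k,Ω}(0)`. Lemma 21.
`Z′_{k,Ω}(0)∕Z_f(N,0) ≤ e^{(Mr_K)⁴}Π_{j=0}^{K−1}exp(O(1)|Ω^{(j+1),c}_{j+1}|)` (458)"*.  p.62 L79–96: *"Proof. We have from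
(12) `Z′_{K,Ω}(0) = Π_{j=0}^{K−1}L^{−8(s_N−s_{N−j−1})}N_{j+1,L^{K−j}Ω_{j+1}}δZ_{j,L^{K−j}Ω}(0)` (459) … Then taking the expression
(415) for `Z_f(N,0)` we have `Z′_{k,Ω}(0)∕Z_f(N,0) = det(D_K(0))⁻¹Π_{j=0}^{K−1}(N_{j+1,Ω_{j+1}(j)}∕N_{j+1})
(δZ_{j,Ω(j)}(0)∕δZ_j(0))` (460)"*.  p.62 L97–124: *"By lemma 10 in [31] and the scale invariance of `|Ω^{(j)}_{j+1}|`
`δZ_{j,Ω(j)}(0) = exp(((1 − L⁻³)log b_j + L⁻³log(b_j + bL⁻¹))|Ω^{(j)}_{j+1}| + Σ_{X∩Ω_{j+1}(j)≠∅}E^d_{j,Ω(j)}(X,0))` (461) where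
`|E^d_{j,Ω(j)}(X,0)| ≤ CM³e^{−κd_M(X)}`. We want to compare this with the global `δZ_j(0) = exp(((1 − L⁻³)log b_j +
L⁻³log(b_j + bL⁻¹))|T⁰_{N−j}| + Σ_X E^d_j(X,0))` (462)"*.  p.63 L1–40: *"But `E^d_{j,Ω}(X,0)` is defined with a random walk
expansion in `X` [31], and if `X ⊂ Ω_{j+1}` this is independent of `Ω`. So `E^d_{j,Ω(j)}(X,0) = E^d_j(X,0)` for `X ⊂
Ω_{j+1}(j)` and we have for the ratio `δZ_{j,Ω(j)}(0)∕δZ_j(0) = exp((…)|Ω^{(j),c}_{j+1}| + Σ_{X#Ω^c_{j+1}(j)}E^d_{j,Ω(j)}(X,0)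
− Σ_{X∩Ω^c_{j+1}(j)≠∅}E^d_j(X,0))` (463) But the first sum in the exponential is bounded by
`CM³Σ_{X∩Ω^c_{j+1}(j)≠∅}e^{−κd_M(X)} ≤ CM³|Ω^c_{j+1}(j)|_M = CVol(Ω^c_{j+1}(j)) = C|Ω^{(j),c}_{j+1}|` (464) The second sum
has the same bound and so `δZ_{j,Ω(j)}(0)∕δZ_j(0) ≤ exp(C|Ω^{(j),c}_{j+1}|)` (465)"*.  p.63 L41–51: *"We also have the
`log N_{j+1,Ω_{j+1}(j)}` is a constant times `|(Ω_{j+1}(j))^{(j+1)}| = |Ω^{(j+1)}_{j+1}|` and so `N_{j+1,Ω_{j+1}(j)}∕N_{j+1} =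
exp(C|Ω^{(j+1),c}_{j+1}|)` (466) The lemma follows from (465), (466) and the following result."* (LEMMA 22 (467):
`|det C_K(0)| ≤ exp((Mr_K)⁴)`.)

**What is formalized (kernel-checked, zero `sorry`, no named facts; theorems only).**  Polymers `X` range over a finite
set `𝒟`; `inΩ X` («`X ⊂ Ω_{j+1}(j)`») and `touchΩ X` («`X ∩ Ω_{j+1}(j) ≠ ∅`») are decidable predicates with
`inΩ ⟹ touchΩ` (polymers are nonempty); `¬inΩ X` = «`X ∩ Ω^c ≠ ∅`», `touchΩ ∧ ¬inΩ` = «`X # Ω^c`».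
* §1 **`eq463_sums`** — the identity behind (463): if `E_Ω(X) = E(X)` whenever `X ⊂ Ω` then
  `Σ_{X∩Ω≠∅}E_Ω(X) − Σ_XE(X) = Σ_{X#Ω^c}E_Ω(X) − Σ_{X∩Ω^c≠∅}E(X)`; **`eq464_bound`**, `eq464_bound_sharp` — (464): each of
  the two sums is at most `a·K₁·v` in modulus when `|E(X)|, |E_Ω(X)| ≤ a·wt(X)` on the polymers meeting `Ω^c` and
  `Σ_{X∩Ω^c≠∅}wt(X) ≤ K₁v`; **`eq465`** — (461)∕(462) ⟹ (465): with `|T| = |Ω| + v`, `v ≥ 0`,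
  `exp(c|Ω| + Σ_{X∩Ω≠∅}E_Ω)∕exp(c|T| + Σ_XE) ≤ exp((|c| + 2aK₁)·v)`.
* §2 `prod_le_exp_sum`; **`lemma21`** — (458) from (460), (465), (466) and (467), constants explicit:
  `Z′∕Z_f ≤ e^{m⁴}·exp((c_N + c_Z)Σ_jv_j)`.

**Readings (declared).**  (i) The formulas (461), (462) (Lemma 10 of [31]) and (466) (Lemma 22 context of [31]) enter as
the displayed exponential forms∕bounds; the tree-decay constant (`Σ_{X∋□}e^{−κd_M(X)} ≤ O(1)`, summed over the cubes of
`Ω^c`) as `Σ_{X∩Ω^c≠∅}wt(X) ≤ K₁·Vol(Ω^c)`.  (ii) The volume coefficient of (463) is bounded by its modulus (whatever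
the sign of `log b_j`).  (iii) `O(1)` in (458) is the explicit `c_N + c_Z`; (460)'s identification `det(D_K(0))⁻¹ =
det C_K(0)` and the ratios' nonnegativity are hypotheses.

**Honest scope.**  Finite-sum and exponential bookkeeping only; `δZ_j`, `N_j`, `E^d_j`, the regions and `D_K(0)` are not
constructed.  No `d = 4` statement; nothing about Bałaban's papers.
-/

noncomputable section

open Finset

namespace Literature.MathematicalPhysics.QuantumFieldTheory.Dimock2011to13

namespace QED3FreeFermionNormalization

/-! ## §1 (461)–(463): the ratio of the regional and the global normalization factors -/

section Ratio

variable {P : Type*}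

/-- **(463), the finite-sum identity**: «if `X ⊂ Ω_{j+1}` this is independent of `Ω`. So `E^d_{j,Ω(j)}(X,0) =
E^d_j(X,0)` for `X ⊂ Ω_{j+1}(j)`» — the polymers inside `Ω` contribute identically to the regional sum
`Σ_{X∩Ω≠∅}E_Ω(X)` ((461)) and the global sum `Σ_X E(X)` ((462)), so
`Σ_{X∩Ω≠∅}E_Ω(X) − Σ_X E(X) = Σ_{X#Ω^c}E_Ω(X) − Σ_{X∩Ω^c≠∅}E(X)` (`X#Ω^c`: `X` meets both `Ω` and `Ω^c`; `inΩ X` =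
`X ⊂ Ω`, `touchΩ X` = `X ∩ Ω ≠ ∅`, and `X ⊂ Ω ⟹ X ∩ Ω ≠ ∅` for the nonempty polymers).
[cite: Dimock2022UVStabilityQED3, §4.2.1 Lemma 21 proof (461)–(463) p.62 L97–124, p.63 L1–24] -/
theorem eq463_sums (𝒟 : Finset P) (inΩ touchΩ : P → Prop) [DecidablePred inΩ] [DecidablePred touchΩ]
    (E EΩ : P → ℝ) (hagree : ∀ X ∈ 𝒟, inΩ X → EΩ X = E X) (hin : ∀ X ∈ 𝒟, inΩ X → touchΩ X) :
    (∑ X ∈ 𝒟.filter touchΩ, EΩ X) - ∑ X ∈ 𝒟, E X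
      = (∑ X ∈ (𝒟.filter touchΩ).filter (fun X => ¬ inΩ X), EΩ X) - ∑ X ∈ 𝒟.filter (fun X => ¬ inΩ X), E X := by
  have h1 : ∑ X ∈ 𝒟.filter touchΩ, EΩ X
      = (∑ X ∈ (𝒟.filter touchΩ).filter inΩ, EΩ X) + ∑ X ∈ (𝒟.filter touchΩ).filter (fun X => ¬ inΩ X), EΩ X :=
    (Finset.sum_filter_add_sum_filter_not _ inΩ _).symm
  have h2 : ∑ X ∈ 𝒟, E X = (∑ X ∈ 𝒟.filter inΩ, E X) + ∑ X ∈ 𝒟.filter (fun X => ¬ inΩ X), E X :=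
    (Finset.sum_filter_add_sum_filter_not _ inΩ _).symm
  have h3 : (𝒟.filter touchΩ).filter inΩ = 𝒟.filter inΩ := by
    ext X
    simp only [Finset.mem_filter]
    constructor
    · rintro ⟨⟨hX, _⟩, hi⟩; exact ⟨hX, hi⟩
    · rintro ⟨hX, hi⟩; exact ⟨⟨hX, hin X hX hi⟩, hi⟩
  have h4 : ∑ X ∈ 𝒟.filter inΩ, EΩ X = ∑ X ∈ 𝒟.filter inΩ, E X :=
    Finset.sum_congr rfl fun X hX => by
      rw [Finset.mem_filter] at hX; exact hagree X hX.1 hX.2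
  rw [h1, h2, h3, h4]
  ring

/-- **(464)**: «the first sum in the exponential is bounded by `CM³Σ_{X∩Ω^c_{j+1}(j)≠∅}e^{−κd_M(X)} ≤ CM³|Ω^c_{j+1}(j)|_M =
CVol(Ω^c_{j+1}(j))`» — a polymer sum over the polymers meeting `Ω^c` with `|F(X)| ≤ a·wt(X)` (`a = CM³`,
`wt(X) = e^{−κd_M(X)}`) and the summed tree decay `Σ_{X∩Ω^c≠∅}wt(X) ≤ K₁·v` (`v = Vol(Ω^c)`) is at most `a·K₁·v` in
modulus. [cite: Dimock2022UVStabilityQED3, §4.2.1 Lemma 21 proof (464) p.63 L25–32] -/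
theorem eq464_bound (𝒟 : Finset P) (bad : P → Prop) [DecidablePred bad] (F : P → ℝ) (wt : P → ℝ) {a K₁ v : ℝ}
    (ha : 0 ≤ a) (hF : ∀ X ∈ 𝒟, bad X → |F X| ≤ a * wt X) (hsum : ∑ X ∈ 𝒟.filter bad, wt X ≤ K₁ * v) :
    |∑ X ∈ 𝒟.filter bad, F X| ≤ a * K₁ * v := by
  refine (Finset.abs_sum_le_sum_abs _ _).trans ?_
  calc ∑ X ∈ 𝒟.filter bad, |F X| ≤ ∑ X ∈ 𝒟.filter bad, a * wt X :=
        Finset.sum_le_sum fun X hX => by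
          rw [Finset.mem_filter] at hX; exact hF X hX.1 hX.2
    _ = a * ∑ X ∈ 𝒟.filter bad, wt X := by rw [Finset.mul_sum]
    _ ≤ a * (K₁ * v) := mul_le_mul_of_nonneg_left hsum ha
    _ = a * K₁ * v := by ring

/-- (464) for the first sum of (463), which runs over the polymers meeting BOTH `Ω` and `Ω^c` — a sub-sum of those
meeting `Ω^c`. [cite: Dimock2022UVStabilityQED3, §4.2.1 Lemma 21 proof (463)–(464) p.63 L17–32] -/
theorem eq464_bound_sharp (𝒟 : Finset P) (inΩ touchΩ : P → Prop) [DecidablePred inΩ] [DecidablePred touchΩ]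
    (F : P → ℝ) (wt : P → ℝ) {a K₁ v : ℝ} (ha : 0 ≤ a)
    (hF : ∀ X ∈ 𝒟, ¬ inΩ X → |F X| ≤ a * wt X)
    (hsum : ∑ X ∈ 𝒟.filter (fun X => ¬ inΩ X), wt X ≤ K₁ * v) :
    |∑ X ∈ (𝒟.filter touchΩ).filter (fun X => ¬ inΩ X), F X| ≤ a * K₁ * v := by
  refine (Finset.abs_sum_le_sum_abs _ _).trans ?_
  have hsub : (𝒟.filter touchΩ).filter (fun X => ¬ inΩ X) ⊆ 𝒟.filter (fun X => ¬ inΩ X) := by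
    intro X hX
    simp only [Finset.mem_filter] at hX ⊢
    exact ⟨hX.1.1, hX.2⟩
  calc ∑ X ∈ (𝒟.filter touchΩ).filter (fun X => ¬ inΩ X), |F X|
      ≤ ∑ X ∈ 𝒟.filter (fun X => ¬ inΩ X), |F X| :=
        Finset.sum_le_sum_of_subset_of_nonneg hsub fun _ _ _ => abs_nonneg _
    _ ≤ ∑ X ∈ 𝒟.filter (fun X => ¬ inΩ X), a * wt X :=
        Finset.sum_le_sum fun X hX => by
          rw [Finset.mem_filter] at hX; exact hF X hX.1 hX.2
    _ = a * ∑ X ∈ 𝒟.filter (fun X => ¬ inΩ X), wt X := by rw [Finset.mul_sum]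
    _ ≤ a * (K₁ * v) := mul_le_mul_of_nonneg_left hsum ha
    _ = a * K₁ * v := by ring

/-- **(465)** «The second sum has the same bound and so `δZ_{j,Ω(j)}(0)∕δZ_j(0) ≤ exp(C|Ω^{(j),c}_{j+1}|)`»: with (461)
`δZ_{j,Ω(j)}(0) = exp(c|Ω^{(j)}_{j+1}| + Σ_{X∩Ω_{j+1}(j)≠∅}E^d_{j,Ω(j)}(X,0))`, (462) `δZ_j(0) = exp(c|T⁰_{N−j}| +
Σ_X E^d_j(X,0))` (`c = (1 − L⁻³)log b_j + L⁻³log(b_j + bL⁻¹)`), `|T| = |Ω| + v` (`v = Vol(Ω^c) ≥ 0`), both kernels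
bounded by `a·wt(X)` on the polymers meeting `Ω^c` and the summed tree decay `≤ K₁v`: the ratio is at most
`exp((|c| + 2aK₁)·v)` — the printed `C = |c| + 2CM³K₁`.
[cite: Dimock2022UVStabilityQED3, §4.2.1 Lemma 21 proof (461)–(465) p.62 L97 – p.63 L40] -/
theorem eq465 (𝒟 : Finset P) (inΩ touchΩ : P → Prop) [DecidablePred inΩ] [DecidablePred touchΩ]
    (E EΩ : P → ℝ) (wt : P → ℝ) {c volΩ volT v a K₁ : ℝ}
    (hvol : volT = volΩ + v) (hv : 0 ≤ v) (hagree : ∀ X ∈ 𝒟, inΩ X → EΩ X = E X)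
    (hin : ∀ X ∈ 𝒟, inΩ X → touchΩ X) (ha : 0 ≤ a)
    (hEΩ : ∀ X ∈ 𝒟, ¬ inΩ X → |EΩ X| ≤ a * wt X) (hE : ∀ X ∈ 𝒟, ¬ inΩ X → |E X| ≤ a * wt X)
    (hsum : ∑ X ∈ 𝒟.filter (fun X => ¬ inΩ X), wt X ≤ K₁ * v) :
    Real.exp (c * volΩ + ∑ X ∈ 𝒟.filter touchΩ, EΩ X) / Real.exp (c * volT + ∑ X ∈ 𝒟, E X)
      ≤ Real.exp ((|c| + 2 * a * K₁) * v) := by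
  rw [← Real.exp_sub]
  refine Real.exp_le_exp.mpr ?_
  have hid := eq463_sums 𝒟 inΩ touchΩ E EΩ hagree hin
  have hb1 := eq464_bound_sharp 𝒟 inΩ touchΩ EΩ wt ha hEΩ hsum
  have hb2 := eq464_bound 𝒟 (fun X => ¬ inΩ X) E wt ha hE hsum
  have hlin : c * volΩ + ∑ X ∈ 𝒟.filter touchΩ, EΩ X - (c * volT + ∑ X ∈ 𝒟, E X)
      = -(c * v) + ((∑ X ∈ 𝒟.filter touchΩ, EΩ X) - ∑ X ∈ 𝒟, E X) := by rw [hvol]; ring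
  rw [hlin, hid]
  have hcv : -(c * v) ≤ |c| * v := by
    calc -(c * v) ≤ |c * v| := neg_le_abs _
      _ = |c| * v := by rw [abs_mul, abs_of_nonneg hv]
  have h1 := (abs_le.mp hb1).2
  have h2 := (abs_le.mp hb2).1
  nlinarith

end Ratio

/-! ## §2 (460), (466), (467) ⟹ LEMMA 21 (458) -/

section Product

variable {J : Type*}

/-- A product of nonnegative factors each at most `e^{Cv_j}` is at most `e^{CΣ_jv_j}` (the form of the right side of
(458)). [cite: Dimock2022UVStabilityQED3, §4.2.1 Lemma 21 (458) p.62 L67–78] -/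
theorem prod_le_exp_sum (s : Finset J) (f v : J → ℝ) {C : ℝ} (hf0 : ∀ j ∈ s, 0 ≤ f j)
    (hf : ∀ j ∈ s, f j ≤ Real.exp (C * v j)) :
    ∏ j ∈ s, f j ≤ Real.exp (C * ∑ j ∈ s, v j) := by
  rw [Finset.mul_sum, Real.exp_sum]
  exact Finset.prod_le_prod hf0 hf

/-- **LEMMA 21 (458)** «`Z′_{k,Ω}(0)∕Z_f(N,0) ≤ e^{(Mr_K)⁴}Π_{j=0}^{K−1}exp(O(1)|Ω^{(j+1),c}_{j+1}|)`» — «The lemma follows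
from (465), (466) and the following result [LEMMA 22]»: from (460) `Z′_{k,Ω}(0)∕Z_f(N,0) = det(D_K(0))⁻¹·Π_j
(N_{j+1,Ω_{j+1}(j)}∕N_{j+1})(δZ_{j,Ω(j)}(0)∕δZ_j(0))` with `det(D_K(0))⁻¹ = det C_K(0)`, (466) `N-ratio_j ≤ e^{c_Nv_j}`,
(465) `δZ-ratio_j ≤ e^{c_Zv_j}` (ratios of positive normalization factors, `≥ 0`) and LEMMA 22 (467) `|det C_K(0)| ≤
e^{m⁴}` (`m = Mr_K`; in the tree as `QED3FinalCovarianceDeterminant.lemma22_det_bound`):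
`Z′∕Z_f ≤ e^{m⁴}·exp((c_N + c_Z)Σ_jv_j)`, `v_j = |Ω^{(j+1),c}_{j+1}|`.
[cite: Dimock2022UVStabilityQED3, §4.2.1 Lemma 21 (458) p.62 L65–78; proof (459)–(460) p.62 L79–96, (466) p.63 L41–51; Lemma 22 (467) p.63 L52–55] -/
theorem lemma21 (s : Finset J) (Nr Zr v : J → ℝ) {ratio detC m cN cZ : ℝ}
    (h460 : ratio = detC * ∏ j ∈ s, (Nr j * Zr j)) (h467 : |detC| ≤ Real.exp (m ^ 4))
    (hN0 : ∀ j ∈ s, 0 ≤ Nr j) (h466 : ∀ j ∈ s, Nr j ≤ Real.exp (cN * v j))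
    (hZ0 : ∀ j ∈ s, 0 ≤ Zr j) (h465 : ∀ j ∈ s, Zr j ≤ Real.exp (cZ * v j)) :
    ratio ≤ Real.exp (m ^ 4) * Real.exp ((cN + cZ) * ∑ j ∈ s, v j) := by
  have hprod0 : 0 ≤ ∏ j ∈ s, (Nr j * Zr j) := Finset.prod_nonneg fun j hj => mul_nonneg (hN0 j hj) (hZ0 j hj)
  have hprod : ∏ j ∈ s, (Nr j * Zr j) ≤ Real.exp ((cN + cZ) * ∑ j ∈ s, v j) := by
    refine prod_le_exp_sum s _ v (fun j hj => mul_nonneg (hN0 j hj) (hZ0 j hj)) fun j hj => ?_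
    rw [add_mul, Real.exp_add]
    exact mul_le_mul (h466 j hj) (h465 j hj) (hZ0 j hj) (Real.exp_pos _).le
  rw [h460]
  calc detC * ∏ j ∈ s, (Nr j * Zr j) ≤ |detC| * ∏ j ∈ s, (Nr j * Zr j) :=
        mul_le_mul_of_nonneg_right (le_abs_self _) hprod0
    _ ≤ Real.exp (m ^ 4) * Real.exp ((cN + cZ) * ∑ j ∈ s, v j) :=
        mul_le_mul h467 hprod hprod0 (Real.exp_pos _).le

end Product


end QED3FreeFermionNormalization

end Literature.MathematicalPhysics.QuantumFieldTheory.Dimock2011to13
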